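import Summits.ResolutionOfSingularities.ResolutionOfSingularities.Theorems.AbhyankarShadowsShadowsUniformizeDenseTranscStep
import Summits.ResolutionOfSingularities.ResolutionOfSingularities.Theorems.AbhyankarShadowsShadowsUniformizeDenseAlgStep
import Literature.AlgebraicGeometry.Resolution.KnafKuhlmann2009Prop310
import Literature.AlgebraicGeometry.Resolution.AbhyankarEtaleAscentProofs
import Literature.AlgebraicGeometry.Resolution.FiniteExtensionUniformizationProofs
import Literature.AlgebraicGeometry.Resolution.ValuedFunctionFieldsLemmas
import Literature.AlgebraicGeometry.Resolution.SeparablyDefectlessDenseDescent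
import HarnessLib

/-!
# Knaf–Kuhlmann 2009, Prop. 3.11 over an Abhyankar base — ambient form (`stub_denseTower_ambient`)

Line `birth` of the crux `ShadowsUniformize` (stmt-ResolutionOfSingularities-16756, route
`AbhyankarShadows`), DENSE-ABHYANKAR BRANCH (lead c2): the tower induction of Knaf–Kuhlmann 2009,
Prop. 3.11, with a general Abhyankar base field `F₀` in place of the rational function field
`k(t)` of a uniformizer (the discrete case is `knafKuhlmann2009_thm15_discrete`).

Knaf–Kuhlmann 2009 (Adv. Math. 221 = arXiv:math/0702856), Thm. 1.5: "Let `(F|K,P)` be a valued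
function field with the property that `(F,P)` lies in the completion of a subfunction field
`(F₀,P|_{F₀})` such that `P|_{F₀}` is an Abhyankar place of `F₀|K` […]. If `P|_K = id_K`, then
`P` is strongly smoothly `K`-uniformizable"; its proof rests on Prop. 3.11: "Let `(L|K,P)` be a
finitely generated, separable extension within the completion of `(K,P)`. Then `P` is strongly
smoothly `O_K`-uniformizable." (§3.4, p. 14: induction on a separating transcendence basis with
Lemmas 2.16, 3.9 and Cor. 3.6, then "`L` must lie within the henselization of `K(T)`. Hence by
Lemma 3.7 …"), applied over the base `K := F₀`, on which `P` is strongly smoothly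
`K`-uniformizable by Knaf–Kuhlmann 2005, Thm. 1.1.

Ambient rendering (`ValuedFunctionFields.lean`): one algebraically closed valued field `(Ω, V)`,
subfields `k' ≤ F₀ ≤ K'` with `k'` perfect and `⊆ O_V`, `F₀|k'` finitely generated, `V ∩ F₀` an
Abhyankar place of `F₀|k'`, `F₀` dense in `K'` (`IsDenseIn V F₀ K'`), and a separating tower
`x : Fin n → K'` over `F₀` (each `x i` transcendental over `F₀(x j : j < i)`, and
`K' | F₀(x)` finite separable). Conclusion: every finite `Z ⊆ O_V ∩ K'` is smoothly
`O_{k'}`-uniformizable.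

Proof (all ingredients proved in the tree):
* base `F₀`: Knaf–Kuhlmann 2005, Cor. 2.2 (`KnafKuhlmann2005_Cor22_holds`) makes the residue
  field extension of the Abhyankar place finitely generated, hence separably generated over the
  perfect residue field of `k'` (`perfectField_resField`,
  `separablyGeneratedOver_of_perfectField`); Knaf–Kuhlmann 2005, Thm. 1.1
  (`KnafKuhlmann2005_Thm11_holds`) gives smooth `k'`-uniformizability of `F₀`, which is smooth
  `O_{k'} = V ∩ k'`-uniformizability (`isSmoothlyUniformizableIn_inf_iff`);
* tower `E i := F₀(x j : j < i)`, `E 0 = F₀`, `E n = F₀(x)`, each `E i` dense in every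
  `F ≤ K'`; the dense transcendental steps `E i ≤ E (i+1) = E i (x i)` (`stub_denseTranscStep` =
  Lemma 2.16 in the completion case + Lemma 3.9) and the final dense finite separable step
  `E n ≤ K'` (`stub_denseAlgStep` = henselization + Hensel-root generator + Lemma 3.7 (2)),
  stacked by Cor. 3.6 (`knafKuhlmann2009_cor36`).

## Sources

* [KK09] H. Knaf, F.-V. Kuhlmann, *Every place admits local uniformization in a finite extension
  of the function field*, Adv. Math. 221 (2009) 428–453 = arXiv:math/0702856: Thm. 1.5 (p. 5),
  Prop. 3.11 and proof of Thm. 1.5 (§3.4, pp. 14–15 of the arXiv PDF). [KnafKuhlmann2009]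
* [KK05] H. Knaf, F.-V. Kuhlmann, *Abhyankar places admit local uniformization in any
  characteristic*, Ann. Sci. ÉNS 38 (2005), Thm. 1.1 and Cor. 2.2. [KnafKuhlmann2005]
-/

noncomputable section

-- single-problem summit: the doubled namespace component is forced
set_option linter.dupNamespace false

open Literature.AlgebraicGeometry.Resolution IsLocalRing

namespace Summit.ResolutionOfSingularities.ResolutionOfSingularities.Theorems

/-- **The Abhyankar base of the tower** (Knaf–Kuhlmann 2005, Thm. 1.1 with Cor. 2.2 over a
perfect trivially valued ground field, in `O_{k'}`-form): for `k' ≤ F₀` subfields of the valued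
field `(Ω, V)` with `k'` perfect and `⊆ O_V`, `F₀|k'` finitely generated and `V ∩ F₀` an Abhyankar
place of `F₀|k'`, every finite `Z ⊆ O_V ∩ F₀` is smoothly `O_{k'} = V ∩ k'`-uniformizable: the
residue field extension is finitely generated (Cor. 2.2), hence separably generated over the
perfect residue field of `k'`, so Thm. 1.1 applies; then pass from the field base `k'` to
`V ∩ k'` (`isSmoothlyUniformizableIn_inf_iff`). [cite: KnafKuhlmann2005, Thm. 1.1] -/
theorem isSmoothlyUniformizableIn_abhyankar_base {Ω : Type} [Field Ω] (V : ValuationSubring Ω)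
    (k' F₀ : Subfield Ω) [PerfectField k'] (hk : k' ≤ F₀) (hfg₀ : FGOver k' F₀)
    (hkV : (k' : Set Ω) ⊆ V) (hA : IsAbhyankarPlace V k' F₀)
    (Z : Finset Ω) (hZ : ∀ z ∈ Z, z ∈ V ∧ z ∈ F₀) :
    IsSmoothlyUniformizableIn ↥(V.toSubring ⊓ k'.toSubring) V F₀ (Z : Set Ω) := by
  obtain ⟨-, hresfg⟩ := KnafKuhlmann2005_Cor22_holds Ω V k' F₀ hk hfg₀ hA
  haveI : PerfectField (resField V k') := perfectField_resField hkV
  have hsep₀ : SeparablyGeneratedOver (resField V k') (resField V F₀) :=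
    separablyGeneratedOver_of_perfectField hresfg
  exact (isSmoothlyUniformizableIn_inf_iff V k' hkV F₀ _).mpr
    (KnafKuhlmann2005_Thm11_holds Ω V k' F₀ hk hfg₀ hkV hA hsep₀ Z hZ)

/-- **Knaf–Kuhlmann 2009, Prop. 3.11 over an Abhyankar base, ambient form** (the tower
induction of the proof of Thm. 1.5, case `P|_K = id`). Let `k' ≤ F₀ ≤ K'` be subfields of an
algebraically closed valued field `(Ω, V)` with `k'` perfect and `⊆ O_V`, `F₀|k'` finitely
generated, `V ∩ F₀` an Abhyankar place of `F₀|k'` and `F₀` dense in `K'`; let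
`x : Fin n → K'` be a separating tower over `F₀` (each `x i` transcendental over
`F₀(x j : j < i)`, `K' | F₀(x)` finite separable). Then every finite `Z ⊆ O_V ∩ K'` is smoothly
`O_{k'}`-uniformizable: base `isSmoothlyUniformizableIn_abhyankar_base` (KK05 Thm. 1.1), dense
transcendental steps (`stub_denseTranscStep`) and the final dense finite separable step
(`stub_denseAlgStep`) along the tower `E i := F₀(x j : j < i)`, stacked by Cor. 3.6
(`knafKuhlmann2009_cor36`). [cite: KnafKuhlmann2009, Prop. 3.11 and Thm. 1.5] -/
theorem stub_denseTower_ambient {Ω : Type} [Field Ω] [IsAlgClosed Ω] (V : ValuationSubring Ω)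
    (k' F₀ K' : Subfield Ω) [PerfectField k'] (hk : k' ≤ F₀) (hF₀K : F₀ ≤ K')
    (hfg₀ : FGOver k' F₀) (hkV : (k' : Set Ω) ⊆ V) (hA : IsAbhyankarPlace V k' F₀)
    (hdense : IsDenseIn V F₀ K') (n : ℕ) (x : Fin n → Ω) (hxK : ∀ i, x i ∈ K')
    (htransc : ∀ i : Fin n, ∀ P : Polynomial Ω,
      (∀ m, P.coeff m ∈ Subfield.closure ((F₀ : Set Ω) ∪ x '' {j | j < i})) →
      P.eval (x i) = 0 → P = 0)
    (hfinsep : FiniteSeparableOver (Subfield.closure ((F₀ : Set Ω) ∪ Set.range x)) K')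
    (Z : Finset Ω) (hZ : ∀ z ∈ Z, z ∈ V ∧ z ∈ K') :
    IsSmoothlyUniformizableIn ↥(V.toSubring ⊓ k'.toSubring) V K' (Z : Set Ω) := by
  classical
  -- the tower
  let E : ℕ → Subfield Ω := fun i =>
    Subfield.closure ((F₀ : Set Ω) ∪ x '' {j : Fin n | (j : ℕ) < i})
  have hE0 : E 0 = F₀ := by
    simp only [E]
    rw [show {j : Fin n | (j : ℕ) < 0} = ∅ from
        Set.eq_empty_of_forall_notMem fun j hj => by simp at hj,
      Set.image_empty, Set.union_empty, Subfield.closure_eq]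
  have hF₀E : ∀ i, F₀ ≤ E i := fun i c hc => Subfield.subset_closure (Or.inl hc)
  have hkE : ∀ i, k' ≤ E i := fun i => hk.trans (hF₀E i)
  have hEK : ∀ i, E i ≤ K' := by
    intro i
    refine Subfield.closure_le.mpr ?_
    rintro z (hz | ⟨j, -, rfl⟩)
    · exact hF₀K hz
    · exact hxK j
  have hEmono : ∀ i, E i ≤ E (i + 1) := by
    intro i
    refine Subfield.closure_mono (Set.union_subset_union_right _
      (Set.image_mono fun j (hj : (j : ℕ) < i) => ?_))
    exact Nat.lt_succ_of_lt hj
  have hEstep : ∀ i : Fin n,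
      E ((i : ℕ) + 1) = Subfield.closure (((E i : Subfield Ω) : Set Ω) ∪ {x i}) := by
    intro i
    refine le_antisymm ?_ ?_
    · refine Subfield.closure_le.mpr ?_
      rintro z (hz | ⟨j, hj, rfl⟩)
      · exact Subfield.subset_closure (Or.inl (hF₀E i hz))
      · change (j : ℕ) < i + 1 at hj
        rcases Nat.lt_succ_iff_lt_or_eq.mp hj with hj | hj
        · exact Subfield.subset_closure (Or.inl (Subfield.subset_closure
            (Or.inr ⟨j, hj, rfl⟩)))
        · rw [Fin.ext hj]
          exact Subfield.subset_closure (Or.inr rfl)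
    · refine Subfield.closure_le.mpr ?_
      rintro z (hz | hz)
      · exact hEmono i hz
      · rw [Set.mem_singleton_iff.mp hz]
        exact Subfield.subset_closure (Or.inr ⟨i, Nat.lt_succ_self _, rfl⟩)
  have hEtop : E n = Subfield.closure ((F₀ : Set Ω) ∪ Set.range x) := by
    simp only [E]
    congr
    ext z
    constructor
    · rintro ⟨j, -, rfl⟩; exact ⟨j, rfl⟩
    · rintro ⟨j, rfl⟩; exact ⟨j, j.2, rfl⟩
  -- density along the tower
  have hdenseE : ∀ i, ∀ F : Subfield Ω, F ≤ K' → IsDenseIn V (E i) F := by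
    intro i F hF y hy c hc hc0
    obtain ⟨z, hz, hlt⟩ := hdense y (hF hy) c (hF hc) hc0
    exact ⟨z, hF₀E i hz, hlt⟩
  -- the induction
  have hQ : ∀ i, i ≤ n → ∀ Z : Finset Ω, (∀ z ∈ Z, z ∈ V ∧ z ∈ E i) →
      IsSmoothlyUniformizableIn ↥(V.toSubring ⊓ k'.toSubring) V (E i) (Z : Set Ω) := by
    intro i
    induction i with
    | zero =>
      intro _ Z hZ
      rw [hE0] at hZ ⊢
      exact isSmoothlyUniformizableIn_abhyankar_base V k' F₀ hk hfg₀ hkV hA Z hZ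
    | succ i ih =>
      intro hi Z hZ
      have hi' : i < n := Nat.lt_of_succ_le hi
      let i' : Fin n := ⟨i, hi'⟩
      refine knafKuhlmann2009_cor36 V (hkE i) (hEmono i) (ih hi'.le) ?_ Z hZ
      intro Z' hZ'
      have hstep := hEstep i'
      change E (i + 1) = _ at hstep
      rw [hstep] at hZ' ⊢
      refine stub_denseTranscStep V (E i) (x i') (fun P hP hP0 => htransc i' P (fun m => ?_) hP0)
        (hdenseE i _ (hstep ▸ hEK (i + 1))) Z' hZ'
      exact hP m
  -- the last, separable-algebraic step
  have hEn : E n ≤ K' := hEK n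
  refine knafKuhlmann2009_cor36 V (hkE n) hEn (hQ n le_rfl) ?_ Z hZ
  intro Z' hZ'
  refine stub_denseAlgStep V (E n) K' hEn ?_ (hdenseE n K' le_rfl) Z' hZ'
  rw [hEtop]
  exact hfinsep

end Summit.ResolutionOfSingularities.ResolutionOfSingularities.Theorems

end
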